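import Literature.LinearAlgebra.QuadraticForm.MetabolicSpaces
import Mathlib.LinearAlgebra.QuadraticForm.Dual
import Mathlib.LinearAlgebra.Dual.Lemmas
import HarnessLib

/-!
# Parity of a Lagrangian against the two factors of the standard metabolic space `N* × N`

Topic `LinearAlgebra/QuadraticForm`; namespace `Literature.LinearAlgebra.QuadraticForm`. Theorems only.

The **standard metabolic (split) quadratic space** on `V = N* × N` (`N` a finite-dimensional vector space
over a field `F`, `N* = Module.Dual F N`) is `Q(f, x) = f(x)` (Mathlib `QuadraticForm.dualProd`), with polar
pairing `⟨(f, x), (g, y)⟩ = f(y) + g(x)` (Mathlib `LinearMap.dualProd`); its two factors `X = N* × 0` and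
`Y = 0 × N` are complementary Lagrangians.  Klagsbrun–Mazur–Rubin's Proposition 2.4 (tree
`threeLagrangianParity`: for three Lagrangians `X, Y, Z` of a nondegenerate quadratic space,
`dim X∩Y + dim Y∩Z + dim Z∩X ≡ dim X (mod 2)`) specialises, since `X ∩ Y = 0`, to:

* `even_finrank_inf_add_finrank_inf_add_of_dualProd` — **for every totally isotropic `Z ≤ N* × N` of
  dimension `dim N`, `dim (Z ∩ (N* × 0)) + dim (Z ∩ (0 × N)) ≡ dim N (mod 2)`** — equivalently, the
  symmetric pairing `(z, z') ↦ ⟨π_X z, π_Y z'⟩` on `Z` is ALTERNATING, so has even rank;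
* `two_mul_finrank_le_of_dualProd` — a totally isotropic subspace of `N* × N` has `dim ≤ dim N`;
* bookkeeping: the polar form, its nondegeneracy (`dualProd_separatingLeft`), the
  dimensions of `V`, `X`, `Y` and `X ∩ Y = 0`.

Use (motivation: crux `stmt-BirchSwinnertonDyer-27478`, LINE 49 stub D0≤2): with `N = ⊕_v H¹_𝒮'(ℚ_v, E[2])`,
`N* ≅ ⊕_v H¹_𝒮(ℚ_v, E[2])` (two transverse families of local conditions at finitely many places, in duality
by the local Tate pairing) and `Z` the image of the relaxed Selmer group, this is the relative parity
`dim Sel_𝒮 + dim Sel_𝒮' ≡ #places`-type congruence of KMR Thm. 3.9 without any reference to places.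

## References

* [KlagsbrunMazurRubin2013] Z. Klagsbrun, B. Mazur, K. Rubin, *Disparity in Selmer ranks of quadratic twists
  of elliptic curves*, Ann. of Math. 178 (2013), §2: Def. 2.1, Lemma 2.3, Prop. 2.4 (arXiv:1111.2321).
-/

noncomputable section

namespace Literature.LinearAlgebra.QuadraticForm

open Module QuadraticMap

variable {F : Type*} [Field F] {N : Type*} [AddCommGroup N] [Module F N]

/-- The polar pairing of `Q(f, x) = f(x)` is `⟨(f, x), (g, y)⟩ = f(y) + g(x)` (Mathlib `LinearMap.dualProd`;
private copy of the tree's `polar_dualProd` of `WittClassZero.lean`, to keep the imports light).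
[cite: KlagsbrunMazurRubin2013, Def. 2.1] -/
private theorem polar_dualProd_eq (p q : Module.Dual F N × N) :
    polar (QuadraticForm.dualProd F N) p q = p.1 q.2 + q.1 p.2 := by
  rw [polar, QuadraticForm.dualProd_apply, QuadraticForm.dualProd_apply, QuadraticForm.dualProd_apply,
    Prod.fst_add, Prod.snd_add, LinearMap.add_apply, map_add, map_add]
  abel

/-- The polar pairing of the standard metabolic space `N* × N` is left-separating (nondegenerate): if
`f(y) + g(x) = 0` for all `(g, y)` then `f = 0` (take `g = 0`) and `x = 0` (take `y = 0`, `g` arbitrary;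
`Module.Dual` separates points of a vector space). [cite: KlagsbrunMazurRubin2013, Def. 2.1] -/
theorem dualProd_separatingLeft (p : Module.Dual F N × N)
    (hp : ∀ q : Module.Dual F N × N, polar (QuadraticForm.dualProd F N) p q = 0) : p = 0 := by
  obtain ⟨f, x⟩ := p
  have hf : f = 0 := by
    ext y
    have := hp (0, y)
    rwa [polar_dualProd_eq, LinearMap.zero_apply, add_zero] at this
  have hx : x = 0 := by
    by_contra hx
    obtain ⟨g, hg⟩ := Module.Projective.exists_dual_ne_zero F hx
    have := hp (g, 0)
    rw [polar_dualProd_eq, hf, LinearMap.zero_apply, zero_add] at this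
    exact hg this
  rw [hf, hx]
  rfl

/-- The polar form of `N* × N` is nondegenerate. [cite: KlagsbrunMazurRubin2013, Def. 2.1] -/
theorem polarForm_dualProd_nondegenerate : (polarForm (QuadraticForm.dualProd F N)).Nondegenerate :=
  (polarForm_nondegenerate_iff _).2 dualProd_separatingLeft

variable [FiniteDimensional F N]

/-- `dim (N* × N) = 2 dim N` (the metabolic space `X ⊕ X*` of KMR Def. 2.1 has dimension `2 dim X`). [cite: KlagsbrunMazurRubin2013, Def. 2.1] -/
theorem finrank_dualProd_space : finrank F (Module.Dual F N × N) = 2 * finrank F N := by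
  rw [Module.finrank_prod, Subspace.dual_finrank_eq]
  ring

omit [FiniteDimensional F N] in
/-- The first factor `N* × 0 = ker(snd)` of `N* × N` is totally isotropic for `Q(f, x) = f(x)`.
[cite: KlagsbrunMazurRubin2013, Def. 2.1] -/
theorem isTotallyIsotropic_ker_snd_dualProd :
    IsTotallyIsotropic (QuadraticForm.dualProd F N)
      (LinearMap.ker (LinearMap.snd F (Module.Dual F N) N)) := by
  intro p hp
  rw [LinearMap.mem_ker, LinearMap.snd_apply] at hp
  rw [QuadraticForm.dualProd_apply, hp, map_zero]

omit [FiniteDimensional F N] in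
/-- The second factor `0 × N = ker(fst)` of `N* × N` is totally isotropic for `Q(f, x) = f(x)`.
[cite: KlagsbrunMazurRubin2013, Def. 2.1] -/
theorem isTotallyIsotropic_ker_fst_dualProd :
    IsTotallyIsotropic (QuadraticForm.dualProd F N)
      (LinearMap.ker (LinearMap.fst F (Module.Dual F N) N)) := by
  intro p hp
  rw [LinearMap.mem_ker, LinearMap.fst_apply] at hp
  rw [QuadraticForm.dualProd_apply, hp, LinearMap.zero_apply]

omit [FiniteDimensional F N] in
/-- `dim (N* × 0) = dim N` (the Lagrangian `X*` of the split space, KMR Def. 2.1). [cite: KlagsbrunMazurRubin2013, Def. 2.1] -/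
theorem finrank_ker_snd_dualProd :
    finrank F (LinearMap.ker (LinearMap.snd F (Module.Dual F N) N)) = finrank F N := by
  rw [← LinearMap.range_inl, LinearMap.finrank_range_of_inj LinearMap.inl_injective, Subspace.dual_finrank_eq]

omit [FiniteDimensional F N] in
/-- `dim (0 × N) = dim N` (the Lagrangian `X` of the split space, KMR Def. 2.1). [cite: KlagsbrunMazurRubin2013, Def. 2.1] -/
theorem finrank_ker_fst_dualProd :
    finrank F (LinearMap.ker (LinearMap.fst F (Module.Dual F N) N)) = finrank F N := by
  rw [← LinearMap.range_inr, LinearMap.finrank_range_of_inj LinearMap.inr_injective]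

omit [FiniteDimensional F N] in
/-- `(N* × 0) ∩ (0 × N) = 0`: the two factors of the split space are complementary Lagrangians (KMR Def. 2.1). [cite: KlagsbrunMazurRubin2013, Def. 2.1] -/
theorem ker_snd_inf_ker_fst_dualProd :
    LinearMap.ker (LinearMap.snd F (Module.Dual F N) N) ⊓ LinearMap.ker (LinearMap.fst F (Module.Dual F N) N) = ⊥ := by
  rw [Submodule.eq_bot_iff]
  rintro ⟨f, x⟩ ⟨h1, h2⟩
  simp only [SetLike.mem_coe, LinearMap.mem_ker, LinearMap.snd_apply, LinearMap.fst_apply] at h1 h2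
  rw [h1, h2]
  rfl

/-- **A totally isotropic subspace of the standard metabolic space `N* × N` is at most half-dimensional**:
`dim Z ≤ dim N` (`Z ≤ Z^⊥` and `dim Z + dim Z^⊥ = 2 dim N`).
[cite: KlagsbrunMazurRubin2013, §2 (proof of Prop. 2.4)] -/
theorem two_mul_finrank_le_of_dualProd (Z : Submodule F (Module.Dual F N × N))
    (hZ : ∀ z ∈ Z, z.1 z.2 = 0) : 2 * finrank F Z ≤ 2 * finrank F N := by
  have hiso : IsTotallyIsotropic (QuadraticForm.dualProd F N) Z := fun z hz => by
    rw [QuadraticForm.dualProd_apply]; exact hZ z hz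
  have h1 := LinearMap.BilinForm.finrank_orthogonal polarForm_dualProd_nondegenerate Z
  have h2 := Submodule.finrank_mono hiso.le_orthogonal
  rw [finrank_dualProd_space] at h1
  omega

/-- **KMR Prop. 2.4 against the two factors of `N* × N`.**  For a totally isotropic subspace `Z ≤ N* × N`
(`f(x) = 0` for `(f, x) ∈ Z`) with `dim Z = dim N` (so `Z` is Lagrangian),
`dim (Z ∩ (N* × 0)) + dim (Z ∩ (0 × N)) + dim N` is EVEN.  Proof: `threeLagrangianParity` with `X = N* × 0`,
`Y = 0 × N` (totally isotropic, half-dimensional, `X ∩ Y = 0`).  Equivalently: the symmetric pairing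
`⟨π_X z, π_Y z'⟩` on `Z` is alternating, hence of even rank `dim N − dim(Z ∩ X) − dim(Z ∩ Y)`.
[cite: KlagsbrunMazurRubin2013, Prop. 2.4] -/
theorem even_finrank_inf_add_finrank_inf_add_of_dualProd (Z : Submodule F (Module.Dual F N × N))
    (hZ : ∀ z ∈ Z, z.1 z.2 = 0) (hd : finrank F Z = finrank F N) :
    Even (finrank F ↥(Z ⊓ LinearMap.ker (LinearMap.snd F (Module.Dual F N) N)) +
      finrank F ↥(Z ⊓ LinearMap.ker (LinearMap.fst F (Module.Dual F N) N)) + finrank F N) := by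
  have hiso : ∀ z ∈ Z, QuadraticForm.dualProd F N z = 0 := fun z hz => by
    rw [QuadraticForm.dualProd_apply]; exact hZ z hz
  have h := threeLagrangianParity F (Module.Dual F N × N) (QuadraticForm.dualProd F N) dualProd_separatingLeft
    (LinearMap.ker (LinearMap.snd F (Module.Dual F N) N)) (LinearMap.ker (LinearMap.fst F (Module.Dual F N) N)) Z
    isTotallyIsotropic_ker_snd_dualProd isTotallyIsotropic_ker_fst_dualProd hiso
    (by rw [finrank_ker_snd_dualProd, finrank_dualProd_space])
    (by rw [finrank_ker_fst_dualProd, finrank_dualProd_space])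
    (by rw [hd, finrank_dualProd_space])
  rw [ker_snd_inf_ker_fst_dualProd, finrank_bot, zero_add, finrank_ker_snd_dualProd,
    inf_comm (LinearMap.ker (LinearMap.fst F (Module.Dual F N) N)) Z] at h
  obtain ⟨m, hm⟩ := h
  exact ⟨m, by omega⟩

end Literature.LinearAlgebra.QuadraticForm

end
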